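import Summits.ABC.Harvest.OpenQuestionsGlue
import Literature.Barriers.ABC.BakerMethodBoundsEpsShape
import Literature.NumberTheory.EllipticCurves.PastenDiscriminantBoundAbcShapeProofs
import Literature.NumberTheory.DiophantineGeometry.ConductorRadicalProofs
import Literature.NumberTheory.DiophantineGeometry.MinimalDiscriminantFactorizationProofs
import Literature.NumberTheory.DiophantineGeometry.MinimalDiscriminantProofs
import HarnessLib

/-!
# Route PlacewiseSzpiro, crux `SingleTowerSzpiro` (stmt-ABC-22410), line `birth`:
# calibration of the registered stub `stub_firstDeliverable_towerBelowStewartYu`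

The line's registered stub (critic idea-crit-6's PRICE, «first deliverable = ANY non-trivial single-tower bound
`n_p log p ≤ F(N_E)` with `F` below the trivial `log|Δ_min| ≤` Stewart–Yu») reads, verbatim,

  `FD := ∃ δ > 0, ∃ C, ∀ E/ℚ elliptic, ∀ v, ord_v(Δ_min(E)) · log p_v ≤ C · N_E ^ (1/3 − δ)`.

This file PROVES (no `sorry`, no new axiom, no `def`, no named-fact hypothesis; it imports no `Theses` file and no
module that does — the crux `SingleTowerSzpiro` enters only SPELLED OUT, as in the skeleton's `SingleTowerSzpiro_of`,
so that route edits never rebuild it; the skeleton `Cruxes/SingleTowerSzpiro/Lines/birth.lean` instantiates it BY NAME):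

* §1 `towerBound_iff_logDiscBound`-type dictionary at POLYNOMIAL scales: a uniform single-tower bound
  `C · N^θ` and a whole-discriminant bound `C · N^θ` are the same statement up to `N^η` for every `η > 0`
  (`ω(N_E) ≤ log₂ N_E` towers, `supp Δ_min = supp N_E`; one tower `≤ log|Δ_min|`). So the «single tower»
  weakening of Szpiro has content only at the LOGARITHMIC scale of the crux (`(6+ε) log N_E`), not at `N^θ`.
* §2 **`firstDeliverable_iff_exists_szpiroEpsShape_lt_third`:
  `FD ↔ ∃ α < 1/3, Summit.ABC.Harvest.SzpiroEpsShape α`** — the first deliverable IS an all-`E/ℚ`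
  Szpiro exponent strictly below `1/3`. The harvested record (Pasten, JNT 254 (2024) §1, the docstring of
  `SzpiroEpsShape`): `α = 1` for all `E/ℚ` (Murty–Pasten 2013), `α = 1/3` on Frey–Hellegouarch curves only
  (Stewart–Yu 2001); «every `α < 1` for all `E/ℚ` is OPEN». Hence `FD → SzpiroExponentBelowOne`
  (`szpiroExponentBelowOne_of_firstDeliverable`), Pasten's printed open rung, and FD even asks for `α < 1/3`.
  Also `firstDeliverable_of_singleTowerSzpiro : (SingleTowerSzpiro, spelled out) → FD` (the deliverable sits
  below the crux).
* §3 **Frey transfer and the catalogued barrier**: `epsShapeBound_of_szpiroEpsShape :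
  SzpiroEpsShape α → Literature.Barriers.ABC.EpsShapeBound α` (`α ≥ 0`; Frey–Hellegouarch model of an abc
  triple, `N ∣ 2¹⁰ rad`, `(abc)² ∣ 2⁸ Δ_min`), whence
  `exists_epsShapeBound_lt_third_of_firstDeliverable : FD → ∃ θ < 1/3, EpsShapeBound θ` — an abc-triple
  bound `log c ≪_ε rad^{θ+ε}` with `θ < 1/3`, i.e. STRICTLY BEYOND the Baker-method state of the art
  `Literature.Barriers.ABC.BakerMethodBounds = BakerShapeBound (1/3) 3` (Stewart–Yu 2001, which gives
  `EpsShapeBound (1/3)` and no less: `BakerMethodBoundsThreeRoutesProofs` accounting, `σ = 1` is forced).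

CONSEQUENCE FOR THE LINE (lead's verdict, recorded in `Cruxes/SingleTowerSzpiro/Lines/birth.md` rev 5): the
PRICE's benchmark «trivial `log|Δ_min| ≤` Stewart–Yu» holds on the Frey locus only; as registered over ALL
`E/ℚ`, the first deliverable is not a place-local statement and not a first step — it is the open problem
«Szpiro exponent `< 1/3` for every elliptic curve over `ℚ`», above Pasten's `SzpiroExponentBelowOne` and beyond
the `BakerMethodBounds` barrier even on Frey curves. The honest place-local content the Baker method does give
(single tower `≤ C_η · p · rad^η` at every prime of an abc triple, below Stewart–Yu exactly for
`p ≤ rad^{1/3−δ}`) is proved separately (`Literature/Barriers/ABC/BakerMethodBoundsSinglePlaceProofs.lean`).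

HONESTY (D-0139/D-0140): orderings between typed statements only; no summit, no rung and no stub is proved
here; `SzpiroEpsShape α` (`α < 1`), `SubexponentialSzpiro`, A-PS are NOT abc; typed ≠ proved.
-/

noncomputable section

-- `Summit.<Summit>.<Problem>` is the mandated summit-side namespace (CONVENTIONS §2); for the
-- single-conjunct summit `ABC` the two coincide, so the duplicate `ABC.ABC` is deliberate.
set_option linter.dupNamespace false

namespace Summit.ABC.ABC.Theorems.SingleTowerSzpiroLine

open IsDedekindDomain Finset
open Summit.ABC.Harvest
open Literature.NumberTheory.DiophantineGeometry
open Literature.NumberTheory.EllipticCurves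

/-! ### §1 Single tower versus whole discriminant at polynomial scales -/

/-- **Whole discriminant ⟹ every tower** (trivial direction): a bound `log|Δ_min(E)| ≤ F(E)` bounds
every single tower `ord_v(Δ_min) · log p_v` by the same `F(E)`, because `p_v ^ ord_v(Δ_min) ∣ |Δ_min|`
(`WeierstrassCurve.factorization_minimalDiscriminantNorm_holds`, Silverman AEC VIII.8; the one-tower bound is
`PlacewiseSzpiroCalib.tower_le_log_minimalDiscriminantNorm`, re-derived here to keep this file route-independent).
[folklore] -/
theorem tower_le_of_log_minimalDiscriminantNorm_le (W : WeierstrassCurve ℚ) {F : ℝ}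
    (h : Real.log (W.minimalDiscriminantNorm ℤ : ℝ) ≤ F) (v : HeightOneSpectrum ℤ) :
    (W.ordMinimalDiscriminant v : ℝ) * Real.log (Rat.HeightOneSpectrum.natGenerator v : ℝ) ≤ F := by
  refine le_trans ?_ h
  have hΔ : 0 < W.minimalDiscriminantNorm ℤ := WeierstrassCurve.minimalDiscriminantNorm_pos_holds W
  have hle : Rat.HeightOneSpectrum.natGenerator v ^ W.ordMinimalDiscriminant v ≤
      W.minimalDiscriminantNorm ℤ := by
    rw [← WeierstrassCurve.factorization_minimalDiscriminantNorm_holds W v]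
    exact Nat.ordProj_le _ hΔ.ne'
  have hp : (0 : ℝ) < (Rat.HeightOneSpectrum.natGenerator v : ℝ) := by
    exact_mod_cast (Rat.HeightOneSpectrum.prime_natGenerator v).pos
  rw [← Real.log_pow]
  exact Real.log_le_log (pow_pos hp _) (by exact_mod_cast hle)

/-- **Every tower ⟹ whole discriminant, at the price of a factor `ω(N_E) ≤ log N_E / log 2`**: if every
tower of `E` is `≤ B` with `B ≥ 0`, then `log|Δ_min(E)| ≤ (log N_E / log 2) · B`. Proof:
`log|Δ_min| = Σ_{p ∣ Δ_min} ord_p(Δ_min) log p` (unique factorisation and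
`WeierstrassCurve.factorization_minimalDiscriminantNorm_holds`), the primes of `Δ_min` are those of `N_E`
(`WeierstrassCurve.radical_conductorNorm_eq_holds`, Silverman AEC VIII.11), and `2^{ω(N)} ≤ rad N ≤ N`
(the per-curve core of `PlacewiseSzpiroPayoff`, re-run here route-independently). [folklore] -/
theorem log_minimalDiscriminantNorm_le_log_mul (W : WeierstrassCurve ℚ) [W.IsElliptic] {B : ℝ}
    (hB : 0 ≤ B)
    (h : ∀ v : HeightOneSpectrum ℤ,
      (W.ordMinimalDiscriminant v : ℝ) * Real.log (Rat.HeightOneSpectrum.natGenerator v : ℝ) ≤ B) :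
    Real.log (W.minimalDiscriminantNorm ℤ : ℝ) ≤
      Real.log (W.conductorNorm ℤ : ℝ) / Real.log 2 * B := by
  have hlog2 : (0 : ℝ) < Real.log 2 := Real.log_pos one_lt_two
  -- `log n = Σ_{p ∣ n} v_p(n) log p`
  have hlogn : ∀ n : ℕ, n ≠ 0 →
      Real.log (n : ℝ) = ∑ p ∈ n.primeFactors, (n.factorization p : ℝ) * Real.log (p : ℝ) := by
    intro n hn
    conv_lhs => rw [Nat.prod_primeFactors_pow_factorization hn]
    push_cast
    rw [Real.log_prod]
    · exact Finset.sum_congr rfl fun p _ => by rw [Real.log_pow]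
    · intro p hp
      exact pow_ne_zero _ (by exact_mod_cast (Nat.prime_of_mem_primeFactors hp).ne_zero)
  have hD0 : W.minimalDiscriminantNorm ℤ ≠ 0 := (WeierstrassCurve.minimalDiscriminantNorm_pos_holds W).ne'
  have hN0 : W.conductorNorm ℤ ≠ 0 := (WeierstrassCurve.conductorNorm_pos_holds W).ne'
  have hpf : (W.conductorNorm ℤ).primeFactors = (W.minimalDiscriminantNorm ℤ).primeFactors := by
    rw [← Nat.primeFactors_radical (W.conductorNorm ℤ),
      WeierstrassCurve.radical_conductorNorm_eq_holds W, Nat.primeFactors_radical]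
  -- `Σ_{p ∣ Δ_min} v_p(Δ_min) log p ≤ ω(Δ_min) · B`
  have hsum : ∑ p ∈ (W.minimalDiscriminantNorm ℤ).primeFactors,
      ((W.minimalDiscriminantNorm ℤ).factorization p : ℝ) * Real.log (p : ℝ) ≤
      ∑ p ∈ (W.minimalDiscriminantNorm ℤ).primeFactors, B := by
    refine Finset.sum_le_sum fun p hp => ?_
    have hpp : p.Prime := Nat.prime_of_mem_primeFactors hp
    have hgen : Rat.HeightOneSpectrum.natGenerator
        ((Rat.HeightOneSpectrum.primesEquiv (R := ℤ)).symm ⟨p, hpp⟩) = p :=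
      congrArg Subtype.val ((Rat.HeightOneSpectrum.primesEquiv (R := ℤ)).apply_symm_apply ⟨p, hpp⟩)
    have hfac : (W.minimalDiscriminantNorm ℤ).factorization p =
        W.ordMinimalDiscriminant ((Rat.HeightOneSpectrum.primesEquiv (R := ℤ)).symm ⟨p, hpp⟩) := by
      conv_lhs => rw [← hgen]
      exact WeierstrassCurve.factorization_minimalDiscriminantNorm_holds W _
    have hv := h ((Rat.HeightOneSpectrum.primesEquiv (R := ℤ)).symm ⟨p, hpp⟩)
    rw [hgen] at hv
    rwa [hfac]
  -- `ω(Δ_min) = ω(N) ≤ log N / log 2`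
  have hcard : ((W.minimalDiscriminantNorm ℤ).primeFactors.card : ℝ) ≤
      Real.log (W.conductorNorm ℤ : ℝ) / Real.log 2 := by
    rw [← hpf, le_div_iff₀ hlog2, ← Real.log_pow]
    have h2 : 2 ^ (W.conductorNorm ℤ).primeFactors.card ≤ W.conductorNorm ℤ :=
      calc 2 ^ (W.conductorNorm ℤ).primeFactors.card ≤ ∏ p ∈ (W.conductorNorm ℤ).primeFactors, p :=
            Finset.pow_card_le_prod _ _ 2 fun p hp => (Nat.prime_of_mem_primeFactors hp).two_le
        _ = UniqueFactorizationMonoid.radical (W.conductorNorm ℤ) := Nat.radical_eq_prod_primeFactors.symm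
        _ ≤ W.conductorNorm ℤ := Nat.radical_le_self_iff.mpr hN0
    exact Real.log_le_log (by positivity) (by exact_mod_cast h2)
  calc Real.log (W.minimalDiscriminantNorm ℤ : ℝ)
      = ∑ p ∈ (W.minimalDiscriminantNorm ℤ).primeFactors,
          ((W.minimalDiscriminantNorm ℤ).factorization p : ℝ) * Real.log (p : ℝ) := hlogn _ hD0
    _ ≤ ∑ p ∈ (W.minimalDiscriminantNorm ℤ).primeFactors, B := hsum
    _ = ((W.minimalDiscriminantNorm ℤ).primeFactors.card : ℝ) * B := by rw [Finset.sum_const, nsmul_eq_mul]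
    _ ≤ Real.log (W.conductorNorm ℤ : ℝ) / Real.log 2 * B := mul_le_mul_of_nonneg_right hcard hB

/-- **Polynomial-scale dictionary, tower ⟹ whole.** A uniform single-tower bound `C · N_E^θ` (all `E`,
all `v`) gives, for every `η > 0`, the whole-discriminant bound
`log|Δ_min(E)| ≤ (max C 0 / (η log 2)) · N_E^(θ + η)` (all `E`): `ω(N_E) ≤ log N_E / log 2 ≤ N^η/(η log 2)`.
[folklore] -/
theorem logDisc_rpow_of_tower_rpow {θ C : ℝ}
    (h : ∀ (W : WeierstrassCurve ℚ) [W.IsElliptic] (v : HeightOneSpectrum ℤ),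
      (W.ordMinimalDiscriminant v : ℝ) * Real.log (Rat.HeightOneSpectrum.natGenerator v : ℝ) ≤
        C * (W.conductorNorm ℤ : ℝ) ^ θ)
    {η : ℝ} (hη : 0 < η) (W : WeierstrassCurve ℚ) [W.IsElliptic] :
    Real.log (W.minimalDiscriminantNorm ℤ : ℝ) ≤
      max C 0 / (η * Real.log 2) * (W.conductorNorm ℤ : ℝ) ^ (θ + η) := by
  have hlog2 : (0 : ℝ) < Real.log 2 := Real.log_pos one_lt_two
  have hN1 : (1 : ℝ) ≤ (W.conductorNorm ℤ : ℝ) := by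
    exact_mod_cast WeierstrassCurve.conductorNorm_pos_holds W
  set N : ℝ := (W.conductorNorm ℤ : ℝ) with hN
  have hN0 : (0 : ℝ) ≤ N := by linarith
  have hNθ : 0 ≤ N ^ θ := Real.rpow_nonneg hN0 θ
  have hB : 0 ≤ max C 0 * N ^ θ := mul_nonneg (le_max_right C 0) hNθ
  have h1 : Real.log (W.minimalDiscriminantNorm ℤ : ℝ) ≤ Real.log N / Real.log 2 * (max C 0 * N ^ θ) :=
    log_minimalDiscriminantNorm_le_log_mul W hB fun v =>
      (h W v).trans (mul_le_mul_of_nonneg_right (le_max_left C 0) hNθ)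
  have hlogN : Real.log N ≤ N ^ η / η := Real.log_le_rpow_div hN0 hη
  calc Real.log (W.minimalDiscriminantNorm ℤ : ℝ) ≤ Real.log N / Real.log 2 * (max C 0 * N ^ θ) := h1
    _ ≤ (N ^ η / η) / Real.log 2 * (max C 0 * N ^ θ) := by gcongr
    _ = max C 0 / (η * Real.log 2) * (N ^ θ * N ^ η) := by
        field_simp
    _ = max C 0 / (η * Real.log 2) * N ^ (θ + η) := by
        rw [← Real.rpow_add (by linarith) θ η]

/-- **Polynomial-scale dictionary, whole ⟹ tower.** A whole-discriminant bound `C · N_E^θ` (all `E`) gives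
the single-tower bound with the SAME `C` and `θ` (all `E`, all `v`). [folklore] -/
theorem tower_rpow_of_logDisc_rpow {θ C : ℝ}
    (h : ∀ (W : WeierstrassCurve ℚ) [W.IsElliptic],
      Real.log (W.minimalDiscriminantNorm ℤ : ℝ) ≤ C * (W.conductorNorm ℤ : ℝ) ^ θ)
    (W : WeierstrassCurve ℚ) [W.IsElliptic] (v : HeightOneSpectrum ℤ) :
    (W.ordMinimalDiscriminant v : ℝ) * Real.log (Rat.HeightOneSpectrum.natGenerator v : ℝ) ≤
      C * (W.conductorNorm ℤ : ℝ) ^ θ :=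
  tower_le_of_log_minimalDiscriminantNorm_le W (h W) v

/-! ### §2 The registered first deliverable is an all-`E` Szpiro exponent below `1/3` -/

/-- **FD ⟹ `SzpiroEpsShape (1/3 − δ)`** for the `δ` of FD: for every `ε > 0`,
`log|Δ_min| ≤ (max C 0/(ε log 2)) · N^{(1/3 − δ) + ε}` (`logDisc_rpow_of_tower_rpow`). [folklore] -/
theorem szpiroEpsShape_of_tower_rpow {δ C : ℝ}
    (h : ∀ (W : WeierstrassCurve ℚ) [W.IsElliptic] (v : HeightOneSpectrum ℤ),
      (W.ordMinimalDiscriminant v : ℝ) * Real.log (Rat.HeightOneSpectrum.natGenerator v : ℝ) ≤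
        C * (W.conductorNorm ℤ : ℝ) ^ ((1 : ℝ) / 3 - δ)) :
    SzpiroEpsShape (1 / 3 - δ) := by
  intro ε hε
  exact ⟨max C 0 / (ε * Real.log 2), fun W _ => logDisc_rpow_of_tower_rpow h hε W⟩

/-- **The registered first deliverable ⟺ an all-`E/ℚ` Szpiro exponent strictly below `1/3`.**
`(∃ δ > 0, ∃ C, ∀ E v, tower_v(E) ≤ C · N_E^{1/3−δ}) ↔ ∃ α < 1/3, Summit.ABC.Harvest.SzpiroEpsShape α`.
(⇒) `α = 1/3 − δ` by `szpiroEpsShape_of_tower_rpow`; (⇐) with `ε = (1/3 − α)/2`, `δ = (1/3 − α)/2`: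
one tower `≤ log|Δ_min| ≤ C · N^{α+ε} = C · N^{1/3−δ}`. The right-hand side is OPEN for every `α < 1`
(Pasten, JNT 254 (2024) §1: record `α = 1` all `E`, Murty–Pasten; `α = 1/3` Frey–Hellegouarch only,
Stewart–Yu) — so the left-hand side asks for more than the printed state of the art by a power of `N_E`
on every curve. [folklore] -/
theorem firstDeliverable_iff_exists_szpiroEpsShape_lt_third :
    (∃ δ : ℝ, 0 < δ ∧ ∃ C : ℝ, ∀ (W : WeierstrassCurve ℚ) [W.IsElliptic] (v : HeightOneSpectrum ℤ),
      (W.ordMinimalDiscriminant v : ℝ) * Real.log (Rat.HeightOneSpectrum.natGenerator v : ℝ) ≤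
        C * (W.conductorNorm ℤ : ℝ) ^ ((1 : ℝ) / 3 - δ)) ↔
    ∃ α : ℝ, α < 1 / 3 ∧ SzpiroEpsShape α := by
  constructor
  · rintro ⟨δ, hδ, C, hC⟩
    exact ⟨1 / 3 - δ, by linarith, szpiroEpsShape_of_tower_rpow hC⟩
  · rintro ⟨α, hα, hS⟩
    obtain ⟨C, hC⟩ := hS ((1 / 3 - α) / 2) (by linarith)
    refine ⟨(1 / 3 - α) / 2, by linarith, C, fun W _ v => ?_⟩
    have h := tower_rpow_of_logDisc_rpow hC W v
    have hexp : α + (1 / 3 - α) / 2 = (1 : ℝ) / 3 - (1 / 3 - α) / 2 := by ring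
    rwa [hexp] at h

/-- **FD ⟹ Pasten's printed open rung `SzpiroExponentBelowOne`** (`∃ α < 1, SzpiroEpsShape α`, "the first
rung above the record", OPEN): the critic's first deliverable is at least as hard as it — indeed it gives
`α < 1/3`. [folklore] -/
theorem szpiroExponentBelowOne_of_firstDeliverable
    (hFD : ∃ δ : ℝ, 0 < δ ∧ ∃ C : ℝ, ∀ (W : WeierstrassCurve ℚ) [W.IsElliptic] (v : HeightOneSpectrum ℤ),
      (W.ordMinimalDiscriminant v : ℝ) * Real.log (Rat.HeightOneSpectrum.natGenerator v : ℝ) ≤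
        C * (W.conductorNorm ℤ : ℝ) ^ ((1 : ℝ) / 3 - δ)) :
    SzpiroExponentBelowOne := by
  obtain ⟨α, hα, hS⟩ := firstDeliverable_iff_exists_szpiroEpsShape_lt_third.mp hFD
  exact ⟨α, by linarith, hS⟩

/-- **The crux implies the first deliverable** (`SingleTowerSzpiro → FD`, the crux spelled out verbatim as the
hypothesis; `δ = 1/6`): at `ε = 1`, `7 log N + C ≤ (42 + max C 0) · N^{1/6}` since `log N ≤ 6 N^{1/6}` and
`N ≥ 1`. So FD is genuinely the weaker statement; the content of this file is that it is nevertheless far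
above everything in print. [folklore] -/
theorem firstDeliverable_of_singleTowerSzpiro
    (hX : ∀ ε : ℝ, 0 < ε → ∃ C : ℝ, ∀ (W : WeierstrassCurve ℚ) [W.IsElliptic] (v : HeightOneSpectrum ℤ),
      (W.ordMinimalDiscriminant v : ℝ) * Real.log (Rat.HeightOneSpectrum.natGenerator v : ℝ) ≤
        (6 + ε) * Real.log (W.conductorNorm ℤ : ℝ) + C) :
    ∃ δ : ℝ, 0 < δ ∧ ∃ C : ℝ, ∀ (W : WeierstrassCurve ℚ) [W.IsElliptic] (v : HeightOneSpectrum ℤ),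
      (W.ordMinimalDiscriminant v : ℝ) * Real.log (Rat.HeightOneSpectrum.natGenerator v : ℝ) ≤
        C * (W.conductorNorm ℤ : ℝ) ^ ((1 : ℝ) / 3 - δ) := by
  obtain ⟨C, hC⟩ := hX 1 one_pos
  refine ⟨1 / 6, by norm_num, 42 + max C 0, fun W _ v => ?_⟩
  have hN1 : (1 : ℝ) ≤ (W.conductorNorm ℤ : ℝ) := by
    exact_mod_cast WeierstrassCurve.conductorNorm_pos_holds W
  have hCW := hC W v
  set N : ℝ := (W.conductorNorm ℤ : ℝ) with hN
  have hN0 : (0 : ℝ) ≤ N := by linarith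
  have hexp : (1 : ℝ) / 3 - 1 / 6 = 1 / 6 := by norm_num
  rw [hexp]
  have hpow1 : (1 : ℝ) ≤ N ^ ((1 : ℝ) / 6) := Real.one_le_rpow hN1 (by norm_num)
  have hlog : Real.log N ≤ N ^ ((1 : ℝ) / 6) / (1 / 6) := Real.log_le_rpow_div hN0 (by norm_num)
  have hlog' : 7 * Real.log N ≤ 42 * N ^ ((1 : ℝ) / 6) := by
    have : Real.log N ≤ 6 * N ^ ((1 : ℝ) / 6) := by linarith
    linarith
  have hC0 : C ≤ max C 0 * N ^ ((1 : ℝ) / 6) :=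
    (le_max_left C 0).trans (le_mul_of_one_le_right (le_max_right C 0) hpow1)
  calc (W.ordMinimalDiscriminant v : ℝ) * Real.log (Rat.HeightOneSpectrum.natGenerator v : ℝ)
      ≤ (6 + 1) * Real.log N + C := hCW
    _ = 7 * Real.log N + C := by ring
    _ ≤ 42 * N ^ ((1 : ℝ) / 6) + max C 0 * N ^ ((1 : ℝ) / 6) := add_le_add hlog' hC0
    _ = (42 + max C 0) * N ^ ((1 : ℝ) / 6) := by ring

/-! ### §3 Frey transfer: an all-`E` Szpiro exponent is an abc-triple Baker `ε`-shape -/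

/-- **`SzpiroEpsShape α ⟹ EpsShapeBound α`** (`α ≥ 0`): an all-`E/ℚ` bound `log|Δ_min| ≤ C · N^{α+ε}`
gives `log c ≤ κ · rad(abc)^{α+ε}` for every abc triple (threshold `c₀ = 0`), with
`κ = 4 log 2 + max C 0 · 1024^{α+ε}`. Proof: the Frey–Hellegouarch model `W₀` of the triple
(`exists_frey_model_sq_dvd`: `N ∣ 2¹⁰ rad(abc)`, `(abc)² ∣ 2⁸ |Δ_min|`) has `2 log c ≤ 8 log 2 + log|Δ_min|`
and `N ≤ 1024 · rad`; `rad ≥ 2` absorbs the constant. (Murty–Pasten 2013 §8 / Pasten 2024 §3 pattern, as in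
`epsShapeBound_one_of_discriminant_levelBound`.) [folklore] -/
theorem epsShapeBound_of_szpiroEpsShape {α : ℝ} (hα : 0 ≤ α) (h : SzpiroEpsShape α) :
    Literature.Barriers.ABC.EpsShapeBound α := by
  intro ε hε
  obtain ⟨C, hC⟩ := h ε hε
  refine ⟨4 * Real.log 2 + max C 0 * (1024 : ℝ) ^ (α + ε), 0, fun a b c ht _ => ?_⟩
  obtain ⟨ha, hb, habc, hcop⟩ := id ht
  have hc : 0 < c := by omega
  obtain ⟨W₀, hE, hN, hΔ⟩ := exists_frey_model_sq_dvd ht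
  haveI := hE
  have hΔpos : 0 < (W₀.baseChange ℚ).minimalDiscriminantNorm ℤ :=
    WeierstrassCurve.minimalDiscriminantNorm_pos_holds _
  have hNpos : 0 < (W₀.baseChange ℚ).conductorNorm ℤ := WeierstrassCurve.conductorNorm_pos_holds _
  have hradpos : 0 < rad a b c := by rw [rad_def]; exact Nat.radical_pos _
  have hbound := hC (W₀.baseChange ℚ)
  have hR2 : (2 : ℝ) ≤ (rad a b c : ℝ) := by exact_mod_cast IsABCTriple.two_le_rad ht
  have hN0 : (0 : ℝ) ≤ ((W₀.baseChange ℚ).conductorNorm ℤ : ℝ) := by exact_mod_cast hNpos.le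
  have hD0 : (0 : ℝ) < ((W₀.baseChange ℚ).minimalDiscriminantNorm ℤ : ℝ) := by exact_mod_cast hΔpos
  have hNR : ((W₀.baseChange ℚ).conductorNorm ℤ : ℝ) ≤ 1024 * (rad a b c : ℝ) := by
    have := Nat.le_of_dvd (mul_pos (by positivity) hradpos) hN
    exact_mod_cast this
  have hc2 : (c : ℝ) ^ 2 ≤ 2 ^ 8 * ((W₀.baseChange ℚ).minimalDiscriminantNorm ℤ : ℝ) := by
    have h1 : c ≤ a * b * c := Nat.le_mul_of_pos_left c (by positivity)
    have h2 : (a * b * c) ^ 2 ≤ 2 ^ 8 * (W₀.baseChange ℚ).minimalDiscriminantNorm ℤ :=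
      Nat.le_of_dvd (by positivity) hΔ
    have h3 : c ^ 2 ≤ 2 ^ 8 * (W₀.baseChange ℚ).minimalDiscriminantNorm ℤ :=
      (Nat.pow_le_pow_left h1 2).trans h2
    exact_mod_cast h3
  set N : ℝ := ((W₀.baseChange ℚ).conductorNorm ℤ : ℝ) with hNdef
  set D : ℝ := ((W₀.baseChange ℚ).minimalDiscriminantNorm ℤ : ℝ) with hDdef
  set R : ℝ := (rad a b c : ℝ) with hRdef
  have hR0 : (0 : ℝ) < R := by linarith
  have hlogc : 2 * Real.log c ≤ 8 * Real.log 2 + Real.log D := by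
    have h1 : Real.log ((c : ℝ) ^ 2) ≤ Real.log (2 ^ 8 * D) := Real.log_le_log (by positivity) hc2
    rw [Real.log_pow, Real.log_mul (by positivity) hD0.ne', Real.log_pow] at h1
    push_cast at h1
    linarith
  -- `log D ≤ max C 0 · N^{α+ε} ≤ max C 0 · 1024^{α+ε} · R^{α+ε}`
  have hαε : 0 < α + ε := by linarith
  have hNpow : N ^ (α + ε) ≤ (1024 : ℝ) ^ (α + ε) * R ^ (α + ε) := by
    rw [← Real.mul_rpow (by norm_num) hR0.le]
    exact Real.rpow_le_rpow hN0 hNR hαε.le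
  have hD1 : Real.log D ≤ max C 0 * ((1024 : ℝ) ^ (α + ε) * R ^ (α + ε)) :=
    calc Real.log D ≤ C * N ^ (α + ε) := hbound
      _ ≤ max C 0 * N ^ (α + ε) := mul_le_mul_of_nonneg_right (le_max_left C 0) (Real.rpow_nonneg hN0 _)
      _ ≤ max C 0 * ((1024 : ℝ) ^ (α + ε) * R ^ (α + ε)) :=
          mul_le_mul_of_nonneg_left hNpow (le_max_right C 0)
  -- `R^{α+ε} ≥ 1` absorbs `4 log 2`
  have hRpow1 : (1 : ℝ) ≤ R ^ (α + ε) := Real.one_le_rpow (by linarith) hαε.le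
  have hl2 : (0 : ℝ) < Real.log 2 := Real.log_pos one_lt_two
  have h4 : 4 * Real.log 2 ≤ 4 * Real.log 2 * R ^ (α + ε) :=
    le_mul_of_one_le_right (by positivity) hRpow1
  calc Real.log c ≤ 4 * Real.log 2 + max C 0 * ((1024 : ℝ) ^ (α + ε) * R ^ (α + ε)) / 2 := by
        linarith
    _ ≤ 4 * Real.log 2 * R ^ (α + ε) + max C 0 * ((1024 : ℝ) ^ (α + ε) * R ^ (α + ε)) := by
        have h0 : 0 ≤ max C 0 * ((1024 : ℝ) ^ (α + ε) * R ^ (α + ε)) := by positivity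
        linarith
    _ = (4 * Real.log 2 + max C 0 * (1024 : ℝ) ^ (α + ε)) * R ^ (α + ε : ℝ) := by ring

/-- **FD ⟹ an abc-triple `ε`-shape with exponent `< 1/3`**: `∃ θ < 1/3, EpsShapeBound θ`
(`θ = max (1/3 − δ) 0`). For comparison, the catalogued Baker-method barrier
`Literature.Barriers.ABC.BakerMethodBounds = BakerShapeBound (1/3) 3` (Stewart–Yu 2001, PROVED in the tree
from Yu's `p`-adic theorem) gives `EpsShapeBound (1/3)` and the three-routes accounting shows the Baker
method gives no smaller exponent; so the first deliverable, as registered over all `E/ℚ`, would improve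
Stewart–Yu 2001 on abc triples. [folklore] -/
theorem exists_epsShapeBound_lt_third_of_firstDeliverable
    (hFD : ∃ δ : ℝ, 0 < δ ∧ ∃ C : ℝ, ∀ (W : WeierstrassCurve ℚ) [W.IsElliptic] (v : HeightOneSpectrum ℤ),
      (W.ordMinimalDiscriminant v : ℝ) * Real.log (Rat.HeightOneSpectrum.natGenerator v : ℝ) ≤
        C * (W.conductorNorm ℤ : ℝ) ^ ((1 : ℝ) / 3 - δ)) :
    ∃ θ : ℝ, θ < 1 / 3 ∧ Literature.Barriers.ABC.EpsShapeBound θ := by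
  obtain ⟨α, hα, hS⟩ := firstDeliverable_iff_exists_szpiroEpsShape_lt_third.mp hFD
  refine ⟨max α 0, max_lt hα (by norm_num), ?_⟩
  exact epsShapeBound_of_szpiroEpsShape (le_max_right α 0) (szpiroEpsShape_mono (le_max_left α 0) hS)

end Summit.ABC.ABC.Theorems.SingleTowerSzpiroLine

end
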